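import Summits.BirchSwinnertonDyer.BirchSwinnertonDyer.Theorems.GoldfeldK12AdditiveTwoBaseChange
import Summits.BirchSwinnertonDyer.BirchSwinnertonDyer.Theorems.GoldfeldAllTwistsTwoConverseTwinAdditiveRootNumber
import Literature.NumberTheory.EllipticCurves.BSDHeegnerPointsModularityOnlyProofs
import Literature.NumberTheory.EllipticCurves.HeegnerHypothesisKroneckerProofs
import Literature.NumberTheory.EllipticCurves.AnalyticRankModularityProofs
import HarnessLib

set_option linter.dupNamespace false -- namespace `…BirchSwinnertonDyer.BirchSwinnertonDyer…` is the cell's (D-0017 nested layout)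
set_option autoImplicit false

/-!
# Crux K12₂″ (item 20044) over the `2`-RAMIFIED Heegner fields of `X₀(49)`: the Heegner sub-leaf of
# `X049KLevelTwoConverseEvenDiscr`, i.e. the one face of the crux whose ANALYTIC half is refereed print
# (Kriz 2021, supersingular `p`-adic Waldspurger formula at `p = 2` ramified in `K`)

Cell `bsd-goldfeld`, prover seat `bsd-goldfeld-s1p-c201` (gen 4), `--supports stmt-BirchSwinnertonDyer-20044`
(route decl `Summit.BirchSwinnertonDyer.BirchSwinnertonDyer.Theses.GoldfeldAllTwistsTwoConverse.RankOneTwoConverseCMSevenAdditiveTwo`,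
K12₂″: for every globally minimal elliptic `W/ℚ` with `j(W) = −3375`, NOT good at `2`,
`corank_{ℤ₂} Sel_{2^∞}(W/ℚ) = 1 ⟹ ord_{s=1} L(W, s) = 1`). The item is OPEN mathematics; NOTHING HERE PROVES IT.
Companion memo: `run/shared/lean/pub/bsd-goldfeld/K12PP-KRIZ-RAMIFIED.md`.

## What this file adds to seat c201's file 1 (`GoldfeldK12AdditiveTwoBaseChange`, p418192)

File 1 proved K12₂″ ⟺ `X049KLevelTwoConverseEvenDiscr`: the rank-one `2^∞`-Selmer converse for the ONE
good-ordinary-at-`2` curve `E₀ = X₀(49) = cm7` over EVERY imaginary quadratic `K` with `4 ∣ d_K` (`2` ramified).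
Those `K` split into two halves at the prime `7` (`N(E₀) = 49 = 7²`):

* `7` SPLIT in `K` — the classical Heegner hypothesis for `(X₀(49), K)` holds, `E₀(K)` carries the Heegner point
  `P_K = Tr_{H_K/K} φ(τ)` (tree: `IsHeegnerPoint 49 cm7 K`), and by Gross–Zagier (Cai–Shu–Tian's explicit form
  for even `d_K`, tree fact `gross_zagier`) `ord_{s=1} L(E₀/K, s) = 1 ⟺ P_K ∉ E₀(K)_tors`. On this half the
  `K`-level converse IS "corank `1` forces the Heegner point off the torsion" — the statement
  `X049HeegnerNonTorsionEvenDiscr` below (**OPEN, `@[conjecture]`, nothing asserted**), and — this is the point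
  of the file, see the memo — its ANALYTIC half is in refereed print: D. Kriz, *Supersingular p-adic
  L-functions, Maass–Shimura operators and Waldspurger formulas*, Ann. of Math. Studies 212 (2021), Thm. 9.10
  (with Thms. 8.9, 8.14; `q = 8`, `b = 3` carry `p = 2`; hypotheses: weight `k = 2` even, `p ∤ N = 49`,
  `p` inert or RAMIFIED in `K`, classical Heegner hypothesis) gives an anticyclotomic `2`-adic `L`-function
  `𝓛_{2,α}(f₄₉/K, ·)` with `𝓛_{2,α}(f₄₉/K, 𝐍_K) = Ω(A,t) · Ξ₂ · log_{ω}(P_K)`, `Ξ₂ = (3 − a₂)/4 ≠ 0` (`a₂(49a1) = 1`).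
  What is NOT in print is the ALGEBRAIC half "corank_{ℤ₂} Sel_{2^∞}(E₀/K) = 1 ⟹ 𝓛_{2,α}(f₄₉/K, 𝐍_K) ≠ 0"
  (an anticyclotomic main-conjecture divisibility + control at `p = 2`, `2` ramified in `K`, `E₀[2]` reducible).
* `7` INERT or RAMIFIED in `K` — no classical Heegner point on `X₀(49)`; Kriz 2021 assumes the classical
  Heegner hypothesis (§8.1, "for convenience"); this half stays with file 1's `L`-function form of the leaf
  (or with seat c201's file 5 leaf over a Heegner field of the big level `784 d²`, where `2` splits).

## Contents (theorems only, plus ONE `@[conjecture]` definition consumed in §2–§3)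

* §1 `X049HeegnerNonTorsionEvenDiscr` — the Heegner sub-leaf (closed `Prop`, nothing asserted).
* §2 It is EXACTLY the Heegner half of file 1's leaf, granted Modularity and Gross–Zagier:
  `kLevelEvenDiscr_heegnerHalf_of_heegnerNonTorsion` (⟸, with the `K`-rationality of Heegner points `hHP`),
  `heegnerNonTorsionEvenDiscr_of_kLevelEvenDiscr` (file 1's leaf ⟹ it), and
  `heegnerNonTorsionEvenDiscr_of_rankOneTwoConverseCMSevenAdditiveTwo` (the crux ⟹ it: an HONESTY clause —
  any proof of item 20044 proves this Heegner statement).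
* §3 THE CRUX ON THE HEEGNER HALF from the sub-leaf: for every globally minimal `W` with `j = −3375`, NOT good
  at `2`, which is `ℚ`-isomorphic to `E₀^{(n)}` for a squarefree `n < 0` with `(n/7) = +1` (equivalently: `7`
  splits in `ℚ(√n)`; these are the twists `49a1^{(D)}` with `D < 0`, `(D/7) = 1`, and — through the isogeny
  `E₀ ∼ E₀^{(−7)}` — those with `D = 7D' > 0`, `(−D'/7) = 1`): `corank_{ℤ₂} Sel_{2^∞}(W) = 1 ⟹ ord_{s=1} L(W,s) = 1`
  (`analyticRank_eq_one_of_heegnerNonTorsionEvenDiscr`). Half of the additive cell, by Chebotarev in `D`.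
* §4 The infinite prime family inside the Heegner half: every model of `49a1^{(−q)}`, `q` prime, `q ≡ 1 (mod 4)`,
  `(q/7) = −1` (so `(−q/7) = +1`): seat c301's descent family (`…TwinAdditivePrimeTwistDescent`), on which the
  crux is the cell's «Conjecture D» (memo K12PP-RINGCLASS §6) — `analyticRank_eq_one_inertPrimeTwist_of_heegnerNonTorsionEvenDiscr`.
* §5 The WHOLE crux (route decl BY NAME) from the two halves at `7`: the Heegner sub-leaf + the `7`-non-split
  half of file 1's leaf (`rankOneTwoConverseCMSevenAdditiveTwo_of_heegnerNonTorsion_of_nonHeegnerHalf`).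

Published inputs, all as the cell's standing cite-tagged binders: Modularity `hnf : ModularForms.exists_isNewformOf`
(gives analytic continuation `hasEntireLFunction_rat_of_exists_isNewformOf` and the sign), Coates–Li–Tian–Zhai
Thm. 1.2 at `R = 1` (`h12`: `L(X₀(49),1) ≠ 0`, rank `0`, `Ш` finite), Gross–Zagier (`hGZ : gross_zagier`), the
`K`-rationality of Heegner points (`hHP : exists_isHeegnerPoint`). No `sorry`, no axiom, no instance, no notation.

References: D. Kriz, Ann. of Math. Studies 212 (2021), Thms. 1.1, 8.9, 8.14, 9.10, §8.1 (bib: Kriz 2021, AMS 212 —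
discussed in the memo only; NOT a binder of any theorem here); B. Gross, D. Zagier, Invent. Math. 84 (1986)
Thm. I.6.3 [GrossZagier1986]; L. Cai, J. Shu, Y. Tian, Algebra Number Theory 8 (2014) Thm. 1.1 [CaiShuTian2014];
B. Gross, in *L-functions and Arithmetic* (1991) (1.1) [Gross1991]; J. Coates, Y. Li, Y. Tian, S. Zhai, PLMS 110
(2015) Thm. 1.2 [CoatesLiTianZhai2015]; A. Burungale, F. Castella, C. Skinner, Y. Tian, Ann. Math. Qué. 46 (2022)
Rem. D [BurungaleCastellaSkinnerTian2022]; T. Dokchitser, parity notes (2013) §4 [Dokchitser2013ParityNotes].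
-/

noncomputable section

open scoped Classical

open WeierstrassCurve Literature.NumberTheory Literature.NumberTheory.EllipticCurves

namespace Summit.BirchSwinnertonDyer.BirchSwinnertonDyer.Theorems.GoldfeldGoodTwists

/-! ## §1 The Heegner sub-leaf over the `2`-ramified Heegner fields of `X₀(49)` -/

/-- **SUB-LEAF `X049HeegnerNonTorsionEvenDiscr` (OPEN; nothing asserted).** For every imaginary quadratic
field `K` with `4 ∣ d_K` (`2` RAMIFIED in `K`) satisfying the classical Heegner hypothesis for `N = 49`
(`7` split in `K`): if `corank_{ℤ₂} Sel_{2^∞}(X₀(49)/K) = 1` then every Heegner point `P_K ∈ X₀(49)(K)` of level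
`49` (`IsHeegnerPoint 49 cm7 K`: trace to `K` of a CM point of `X₀(49)` of discriminant `d_K`) has infinite
order. The Heegner half of `X049KLevelTwoConverseEvenDiscr` (§2). Its analytic half — a `2`-adic
anticyclotomic `L`-function of `f₄₉` over `K` whose value at the norm character is `Ω · Ξ₂ · log P_K`,
`Ξ₂ ≠ 0` — is Kriz 2021 Thm. 9.10 (`p = 2` ramified in `K`, `p ∤ 49`, weight `2`); the algebraic half
(corank `1` ⟹ that value `≠ 0`) is not in print. [cite: BurungaleCastellaSkinnerTian2022, Rem. D (p. 327)]
[cite: GrossZagier1986, Thm. I.(6.3) (the dictionary non-torsion ⟺ ord = 1 used in §2)] -/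
@[conjecture] def X049HeegnerNonTorsionEvenDiscr : Prop :=
  ∀ (K : Type) [Field K] [NumberField K], IsImaginaryQuadratic K → (4 : ℤ) ∣ NumberField.discr K →
    SatisfiesHeegnerHypothesis 49 K → (cm7.baseChange K).selmerCorank 2 = 1 →
    ∀ (P : (cm7.baseChange K).toAffine.Point), IsHeegnerPoint 49 cm7 K P → ¬ IsOfFinAddOrder P

/-! ## §2 The sub-leaf is exactly the Heegner half of `X049KLevelTwoConverseEvenDiscr` -/

/-- Transport of `IsHeegnerPoint` along an equality of levels (the level enters the type of the
parametrisation and Heegner data; `NeZero` is a proposition, so the two instances agree). [folklore] -/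
theorem isHeegnerPoint_of_level_eq {N M : ℕ} [NeZero N] [NeZero M] (h : N = M) {W : WeierstrassCurve ℚ}
    {K : Type} [Field K] [NumberField K] {P : (W.baseChange K).toAffine.Point}
    (hP : IsHeegnerPoint N W K P) : IsHeegnerPoint M W K P := by
  subst h
  exact hP

/-- **The Heegner half of file 1's leaf from the sub-leaf** (Gross–Zagier, nothing at `2`): for `K` imaginary
quadratic with `4 ∣ d_K` and `7` split, a Heegner point `P_K ∈ X₀(49)(K)` exists (`hHP`), the sub-leaf puts it
off the torsion, and `ord_{s=1} L(X₀(49)/K, s) = 1 ⟺ P_K ∉ X₀(49)(K)_tors` (`hGZ` + the sign from Modularity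
`hnf`; tree theorem `analyticRankEK_eq_one_iff_heegner_nonTorsion_of_exists_isNewformOf`, `N(X₀(49)) = 49`).
[cite: GrossZagier1986, Thm. I.(6.3) with V.§2 and I.§7] [cite: Gross1991, (1.1)] -/
theorem kLevelEvenDiscr_heegnerHalf_of_heegnerNonTorsion (hnf : ModularForms.exists_isNewformOf)
    (hGZ : ∀ (N : ℕ) [NeZero N] (W : WeierstrassCurve ℚ) (K : Type) [Field K] [NumberField K],
      gross_zagier N W K)
    (hHP : ∀ (W : WeierstrassCurve ℚ) (K : Type) [Field K] [NumberField K], exists_isHeegnerPoint W K)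
    (hNT : X049HeegnerNonTorsionEvenDiscr) :
    ∀ (K : Type) [Field K] [NumberField K], IsImaginaryQuadratic K → (4 : ℤ) ∣ NumberField.discr K →
      SatisfiesHeegnerHypothesis 49 K → (cm7.baseChange K).selmerCorank 2 = 1 → analyticRankEK cm7 K = 1 := by
  intro K _ _ hK h4 hH hsel
  haveI : NeZero (cm7.conductorNorm ℤ) := ⟨(cm7.conductorNorm_pos_holds).ne'⟩
  have hH' : SatisfiesHeegnerHypothesis (cm7.conductorNorm ℤ) K := by rw [conductorNorm_cm7]; exact hH
  obtain ⟨P, hP0⟩ := hHP cm7 K hK hH'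
  have hP : IsHeegnerPoint 49 cm7 K P := isHeegnerPoint_of_level_eq conductorNorm_cm7 hP0
  have hnt : ¬ IsOfFinAddOrder P := hNT K hK h4 hH hsel P hP
  exact (analyticRankEK_eq_one_iff_heegner_nonTorsion_of_exists_isNewformOf cm7 49 K (hGZ 49 cm7 K) hnf
    hK conductorNorm_cm7 hH hP).mpr hnt

/-- **The sub-leaf from file 1's leaf** `X049KLevelTwoConverseEvenDiscr` (same Gross–Zagier dictionary, forward
direction): `ord_{s=1} L(X₀(49)/K, s) = 1` forces every Heegner point of level `49` in `X₀(49)(K)` off the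
torsion. [cite: GrossZagier1986, Thm. I.(6.3) with V.§2] [cite: Gross1991, (1.1)] -/
theorem heegnerNonTorsionEvenDiscr_of_kLevelEvenDiscr (hnf : ModularForms.exists_isNewformOf)
    (hGZ : ∀ (N : ℕ) [NeZero N] (W : WeierstrassCurve ℚ) (K : Type) [Field K] [NumberField K],
      gross_zagier N W K)
    (hX : X049KLevelTwoConverseEvenDiscr) : X049HeegnerNonTorsionEvenDiscr := by
  intro K _ _ hK h4 hH hsel P hP
  exact (analyticRankEK_eq_one_iff_heegner_nonTorsion_of_exists_isNewformOf cm7 49 K (hGZ 49 cm7 K) hnf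
    hK conductorNorm_cm7 hH hP).mp (hX K hK h4 hsel)

/-- **HONESTY CLAUSE: the crux K12₂″ (route decl, by name) implies the sub-leaf**, granted Modularity,
Coates–Li–Tian–Zhai Thm. 1.2 at `R = 1` and Gross–Zagier (file 1's `kLevelEvenDiscr_of_rankOneTwoConverseCMSevenAdditiveTwo`
then the dictionary). So the sub-leaf is a NECESSARY content of any proof of item 20044: every `2`-converse for
the additive `ℚ(√−7)`-twists proves that corank one forces the level-`49` Heegner points over the `2`-ramified
Heegner fields off the torsion. [cite: CoatesLiTianZhai2015, Thm. 1.2 (p. 359, case r = 0)]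
[cite: GrossZagier1986, Thm. I.(6.3) with V.§2] -/
theorem heegnerNonTorsionEvenDiscr_of_rankOneTwoConverseCMSevenAdditiveTwo
    (hnf : ModularForms.exists_isNewformOf) (h12 : CoatesLiTianZhai2015.thm12_fullBSD_twist)
    (hGZ : ∀ (N : ℕ) [NeZero N] (W : WeierstrassCurve ℚ) (K : Type) [Field K] [NumberField K],
      gross_zagier N W K)
    (hXL : Summit.BirchSwinnertonDyer.BirchSwinnertonDyer.Theses.GoldfeldAllTwistsTwoConverse.RankOneTwoConverseCMSevenAdditiveTwo) :
    X049HeegnerNonTorsionEvenDiscr :=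
  heegnerNonTorsionEvenDiscr_of_kLevelEvenDiscr hnf hGZ
    (kLevelEvenDiscr_of_rankOneTwoConverseCMSevenAdditiveTwo (hasEntireLFunction_rat_of_exists_isNewformOf hnf)
      h12 hXL)

/-! ## §3 The crux on the Heegner half of the additive cell, from the sub-leaf -/

/-- `(4n / 7) = (n / 7)`: the Kronecker symbol at `7` does not see the square factor `4`. [folklore] -/
theorem jacobiSym_four_mul_seven (n : ℤ) : jacobiSym (4 * n) 7 = jacobiSym n 7 := by
  rw [jacobiSym.mul_left, show (4 : ℤ) = 2 ^ 2 by norm_num, jacobiSym.sq_one' (by decide), one_mul]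

/-- **The Heegner hypothesis for `(X₀(49), ℚ(√n))`, `n ≡ 2, 3 (mod 4)` squarefree**: for a quadratic field `K`
with `d_K = 4n`, every prime dividing `49` (i.e. `7`) splits in `K` iff `(n/7) = +1` (decomposition law,
tree theorem `satisfiesHeegnerHypothesis_iff_kronecker`). [folklore] -/
theorem satisfiesHeegnerHypothesis_fortyNine_of_discr_eq (K : Type) [Field K] [NumberField K]
    (h2 : Module.finrank ℚ K = 2) {n : ℤ} (hdK : NumberField.discr K = 4 * n) (hn7 : jacobiSym n 7 = 1) :
    SatisfiesHeegnerHypothesis 49 K := by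
  rw [satisfiesHeegnerHypothesis_iff_kronecker 49 K h2]
  intro p hp hp49
  have hp7 : p = 7 := by
    have h : p ∣ 7 ^ 2 := by simpa using hp49
    exact (Nat.prime_dvd_prime_iff_eq hp (by norm_num)).mp (hp.dvd_of_dvd_pow h)
  subst hp7
  refine ⟨fun h => by omega, fun _ => ?_⟩
  rw [hdK, show ((7 : ℕ) : ℕ) = 7 from rfl]
  exact_mod_cast (jacobiSym_four_mul_seven n).trans hn7

/-- **THE CRUX ON THE HEEGNER HALF, from the sub-leaf.** Assume Modularity (`hnf`), Coates–Li–Tian–Zhai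
Thm. 1.2 at `R = 1` (`h12`), Gross–Zagier (`hGZ`), the `K`-rationality of Heegner points (`hHP`) and the
sub-leaf `X049HeegnerNonTorsionEvenDiscr` (`hNT`). Let `W/ℚ` be elliptic, `ℚ`-isomorphic to `E₀^{(n)}`
(`C • W = cm7^{(n)}`) with `n < 0` squarefree, `n ≢ 1 (mod 4)` (for a globally minimal `W` this is
"NOT good at `2`", file 1 `emod_four_ne_one_of_not_hasGoodReductionAtPrime_two`) and `(n/7) = +1`. Then
`corank_{ℤ₂} Sel_{2^∞}(W/ℚ) = 1 ⟹ ord_{s=1} L(W, s) = 1`. Proof: `K = ℚ(√n)`, `d_K = 4n`, `7` split (§3);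
`corank(E₀/K) = 0 + corank(E₀^{(4n)}) = corank(W) = 1` (file 1 §4); the sub-leaf and Gross–Zagier give
`ord L(E₀/K) = 1 = 0 + ord L(W)`. [cite: CoatesLiTianZhai2015, Thm. 1.2 (p. 359, case r = 0)]
[cite: Dokchitser2013ParityNotes, §4 (first display)] [cite: GrossZagier1986, Thm. I.(6.3) and I.§7]
[cite: BurungaleCastellaSkinnerTian2022, Rem. D (p. 327) (the excluded case)] -/
theorem analyticRank_eq_one_of_heegnerNonTorsionEvenDiscr (hnf : ModularForms.exists_isNewformOf)
    (h12 : CoatesLiTianZhai2015.thm12_fullBSD_twist)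
    (hGZ : ∀ (N : ℕ) [NeZero N] (W : WeierstrassCurve ℚ) (K : Type) [Field K] [NumberField K],
      gross_zagier N W K)
    (hHP : ∀ (W : WeierstrassCurve ℚ) (K : Type) [Field K] [NumberField K], exists_isHeegnerPoint W K)
    (hNT : X049HeegnerNonTorsionEvenDiscr)
    (W : WeierstrassCurve ℚ) [W.IsElliptic] {n : ℤ} (hsq : Squarefree n) (hneg : n < 0) (hn4 : n % 4 ≠ 1)
    (hn7 : jacobiSym n 7 = 1) {C : VariableChange ℚ} (hC : C • W = cm7.quadraticTwist (n : ℚ))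
    (hsel : W.selmerCorank 2 = 1) : W.analyticRank = 1 := by
  have hmod : hasEntireLFunction_rat := hasEntireLFunction_rat_of_exists_isNewformOf hnf
  have hn0 : n ≠ 0 := hsq.ne_zero
  have hnQ : (n : ℚ) ≠ 0 := Int.cast_ne_zero.mpr hn0
  haveI := cm7.isElliptic_quadraticTwist hnQ
  -- `n ≡ 2, 3 (mod 4)`
  have hnsq4 : ¬ (4 : ℤ) ∣ n := fun h4' ↦ by
    have h22 : (2 : ℤ) * 2 ∣ n := by rwa [show (2 : ℤ) * 2 = 4 by norm_num]
    have hu := Int.isUnit_iff.mp (hsq 2 h22)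
    omega
  have hres : n % 4 = 2 ∨ n % 4 = 3 := by omega
  -- `K = ℚ(√n)`, `d_K = 4n`, imaginary, `7` split
  obtain ⟨K, _, _, h2, hdK⟩ := QuadraticFields.Quadratic.exists_numberField_discr_eq (D := 4 * n)
    (Or.inr ⟨dvd_mul_right 4 n, by rw [show 4 * n / 4 = n by omega]; exact hres,
      by rw [show 4 * n / 4 = n by omega]; exact hsq⟩)
  have hK : IsImaginaryQuadratic K :=
    isImaginaryQuadratic_iff_discr_neg.mpr ⟨h2, by rw [hdK]; omega⟩
  have h4K : (4 : ℤ) ∣ NumberField.discr K := hdK ▸ dvd_mul_right 4 n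
  have hH : SatisfiesHeegnerHypothesis 49 K := satisfiesHeegnerHypothesis_fortyNine_of_discr_eq K h2 hdK hn7
  -- `E₀^{(d_K)} = E₀^{(4n)} ≅ E₀^{(n)} ≅ W`
  have htw : cm7.quadraticTwist (NumberField.discr K : ℚ) =
      (⟨(Units.mk0 (2 : ℚ) two_ne_zero)⁻¹, 0, 0, 0⟩ : VariableChange ℚ) • cm7.quadraticTwist (n : ℚ) := by
    rw [hdK]; exact quadraticTwist_cm7_four_mul n
  haveI : (cm7.quadraticTwist (NumberField.discr K : ℚ)).IsElliptic := by rw [htw]; infer_instance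
  have hWdK : IsIsogenous W (cm7.quadraticTwist (NumberField.discr K : ℚ)) := by
    rw [htw]
    exact (isIsogenous_of_smul_eq hC).trans' (isIsogenous_smul _ _)
  -- corank over `K` is `0 + 1`
  have hselK : (cm7.baseChange K).selmerCorank 2 = 1 := by
    rw [selmerCorank_cm7_baseChange h12 K h2, ← hWdK.selmerCorank_eq 2, hsel]
  -- the sub-leaf on the Heegner half, then Artin formalism
  have hEK := kLevelEvenDiscr_heegnerHalf_of_heegnerNonTorsion hnf hGZ hHP hNT K hK h4K hH hselK
  rw [analyticRankEK_cm7 hmod h12 K, ← analyticRank_eq_of_isIsogenous' hWdK] at hEK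
  exact hEK

/-- **The same for a globally minimal `W` NOT good at `2`** (the shape of the crux: the congruence
`n ≢ 1 (mod 4)` is then automatic, file 1). [cite: SilvermanAEC2009, VII.5 Prop. 5.1(a) and X.5 Cor. 5.4.1]
[cite: GrossZagier1986, Thm. I.(6.3) and I.§7] -/
theorem analyticRank_eq_one_of_heegnerNonTorsionEvenDiscr_of_not_good (hnf : ModularForms.exists_isNewformOf)
    (h12 : CoatesLiTianZhai2015.thm12_fullBSD_twist)
    (hGZ : ∀ (N : ℕ) [NeZero N] (W : WeierstrassCurve ℚ) (K : Type) [Field K] [NumberField K],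
      gross_zagier N W K)
    (hHP : ∀ (W : WeierstrassCurve ℚ) (K : Type) [Field K] [NumberField K], exists_isHeegnerPoint W K)
    (hNT : X049HeegnerNonTorsionEvenDiscr)
    (W : WeierstrassCurve ℚ) [W.IsElliptic] [W.IsGloballyMinimal] (hbad : ¬ W.HasGoodReductionAtPrime 2)
    {n : ℤ} (hsq : Squarefree n) (hneg : n < 0) (hn7 : jacobiSym n 7 = 1) {C : VariableChange ℚ}
    (hC : C • W = cm7.quadraticTwist (n : ℚ)) (hsel : W.selmerCorank 2 = 1) : W.analyticRank = 1 :=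
  analyticRank_eq_one_of_heegnerNonTorsionEvenDiscr hnf h12 hGZ hHP hNT W hsq hneg
    (emod_four_ne_one_of_not_hasGoodReductionAtPrime_two W hC hbad) hn7 hC hsel

/-! ## §4 The prime family `49a1^{(−q)}`, `q ≡ 1 (mod 4)` prime, `(q/7) = −1`, lies in the Heegner half -/

/-- `(−q / 7) = +1` for a prime `q ≡ 1 (mod 4)` with `(q/7) = −1` (`(−1/7) = −1` as `7 ≡ 3 (mod 4)`): the
field `ℚ(√−q)` is a `2`-ramified Heegner field for `X₀(49)`. [folklore] -/
theorem jacobiSym_neg_prime_seven {q : ℕ} (hq7 : jacobiSym q 7 = -1) : jacobiSym (-(q : ℤ)) 7 = 1 := by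
  have h1 : jacobiSym (-1) 7 = -1 := by
    rw [jacobiSym.at_neg_one (by decide), ZMod.χ₄_nat_three_mod_four (by norm_num)]
  rw [neg_eq_neg_one_mul, jacobiSym.mul_left, h1, hq7]
  norm_num

/-- **K12₂″ on seat c301's inert PRIME-twist family, from the sub-leaf.** For a prime `q ≡ 1 (mod 4)` inert in
`ℚ(√−7)` (stated as `(q/7) = −1`) and EVERY elliptic `W/ℚ` that is `ℚ`-isomorphic to `E₀^{(−q)} = 49a1^{(−q)}`
(additive at `2`, Kodaira `I₄*`; conductor `784 q²`): `corank_{ℤ₂} Sel_{2^∞}(W/ℚ) = 1 ⟹ ord_{s=1} L(W, s) = 1`,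
granted Modularity, Coates–Li–Tian–Zhai 1.2 at `R = 1`, Gross–Zagier, Heegner rationality and
`X049HeegnerNonTorsionEvenDiscr` — here through the Heegner point of `X₀(49)` over `ℚ(√−q)` (`d_K = −4q`).
On this family the `2`-descent of `…TwinAdditivePrimeTwistDescent` gives rank `≤ 1` unconditionally and the
hypothesis corank `1` is expected for EVERY member (root number `−1`), so the conclusion is the cell's
«Conjecture D(q)»: `L'(49a1^{(−q)}, 1) ≠ 0`. [cite: CoatesLiTianZhai2015, Thm. 1.2 (p. 359, case r = 0)]
[cite: GrossZagier1986, Thm. I.(6.3) and I.§7] -/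
theorem analyticRank_eq_one_inertPrimeTwist_of_heegnerNonTorsionEvenDiscr
    (hnf : ModularForms.exists_isNewformOf) (h12 : CoatesLiTianZhai2015.thm12_fullBSD_twist)
    (hGZ : ∀ (N : ℕ) [NeZero N] (W : WeierstrassCurve ℚ) (K : Type) [Field K] [NumberField K],
      gross_zagier N W K)
    (hHP : ∀ (W : WeierstrassCurve ℚ) (K : Type) [Field K] [NumberField K], exists_isHeegnerPoint W K)
    (hNT : X049HeegnerNonTorsionEvenDiscr)
    {q : ℕ} (hq : q.Prime) (hq4 : q % 4 = 1) (hq7 : jacobiSym q 7 = -1)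
    (W : WeierstrassCurve ℚ) [W.IsElliptic] (C : VariableChange ℚ)
    (hC : C • W = cm7.quadraticTwist ((-q : ℤ) : ℚ)) (hsel : W.selmerCorank 2 = 1) :
    W.analyticRank = 1 := by
  have hsq : Squarefree (-(q : ℤ)) := by
    rw [← Int.squarefree_natAbs, Int.natAbs_neg, Int.natAbs_natCast]
    exact hq.squarefree
  exact analyticRank_eq_one_of_heegnerNonTorsionEvenDiscr hnf h12 hGZ hHP hNT W hsq
    (by have := hq.pos; omega) (by omega) (jacobiSym_neg_prime_seven hq7) hC hsel

/-! ## §5 The whole crux from the two halves at `7`: Heegner sub-leaf + the non-Heegner half of file 1's leaf -/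

/-- **File 1's leaf from its two halves at `7`.** `X049KLevelTwoConverseEvenDiscr` follows from the Heegner
sub-leaf (`hNT`, the `K` with `7` split — via Gross–Zagier, §2) together with its own restriction to the `K` in
which `7` does NOT split (`hRest`: `7` inert or ramified, no classical Heegner point on `X₀(49)`).
[cite: GrossZagier1986, Thm. I.(6.3) with V.§2] [cite: Gross1991, (1.1)] -/
theorem kLevelEvenDiscr_of_heegnerNonTorsion_of_nonHeegnerHalf (hnf : ModularForms.exists_isNewformOf)
    (hGZ : ∀ (N : ℕ) [NeZero N] (W : WeierstrassCurve ℚ) (K : Type) [Field K] [NumberField K],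
      gross_zagier N W K)
    (hHP : ∀ (W : WeierstrassCurve ℚ) (K : Type) [Field K] [NumberField K], exists_isHeegnerPoint W K)
    (hNT : X049HeegnerNonTorsionEvenDiscr)
    (hRest : ∀ (K : Type) [Field K] [NumberField K], IsImaginaryQuadratic K → (4 : ℤ) ∣ NumberField.discr K →
      ¬ SatisfiesHeegnerHypothesis 49 K → (cm7.baseChange K).selmerCorank 2 = 1 → analyticRankEK cm7 K = 1) :
    X049KLevelTwoConverseEvenDiscr := by
  intro K _ _ hK h4 hsel
  by_cases hH : SatisfiesHeegnerHypothesis 49 K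
  · exact kLevelEvenDiscr_heegnerHalf_of_heegnerNonTorsion hnf hGZ hHP hNT K hK h4 hH hsel
  · exact hRest K hK h4 hH hsel

/-- **CRUX K12₂″ (route decl, by name) from the Heegner sub-leaf and the non-Heegner half**, granted
Modularity (`hnf`), Coates–Li–Tian–Zhai Thm. 1.2 at `R = 1` (`h12`), Gross–Zagier (`hGZ`) and the
`K`-rationality of Heegner points (`hHP`): file 1's `rankOneTwoConverseCMSevenAdditiveTwo_of_kLevelEvenDiscr`
fed with §5's reassembled leaf. The two open inputs are `X049HeegnerNonTorsionEvenDiscr` (analytic half in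
print: Kriz 2021 Thm. 9.10; algebraic half open) and the `7`-non-split half of `X049KLevelTwoConverseEvenDiscr`
(no Heegner point of level `49`; open on both halves). [cite: CoatesLiTianZhai2015, Thm. 1.2 (p. 359, case r = 0)]
[cite: GrossZagier1986, Thm. I.(6.3) and I.§7] [cite: BurungaleCastellaSkinnerTian2022, Rem. D (p. 327)] -/
theorem rankOneTwoConverseCMSevenAdditiveTwo_of_heegnerNonTorsion_of_nonHeegnerHalf
    (hnf : ModularForms.exists_isNewformOf) (h12 : CoatesLiTianZhai2015.thm12_fullBSD_twist)
    (hGZ : ∀ (N : ℕ) [NeZero N] (W : WeierstrassCurve ℚ) (K : Type) [Field K] [NumberField K],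
      gross_zagier N W K)
    (hHP : ∀ (W : WeierstrassCurve ℚ) (K : Type) [Field K] [NumberField K], exists_isHeegnerPoint W K)
    (hNT : X049HeegnerNonTorsionEvenDiscr)
    (hRest : ∀ (K : Type) [Field K] [NumberField K], IsImaginaryQuadratic K → (4 : ℤ) ∣ NumberField.discr K →
      ¬ SatisfiesHeegnerHypothesis 49 K → (cm7.baseChange K).selmerCorank 2 = 1 → analyticRankEK cm7 K = 1) :
    Summit.BirchSwinnertonDyer.BirchSwinnertonDyer.Theses.GoldfeldAllTwistsTwoConverse.RankOneTwoConverseCMSevenAdditiveTwo :=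
  rankOneTwoConverseCMSevenAdditiveTwo_of_kLevelEvenDiscr (hasEntireLFunction_rat_of_exists_isNewformOf hnf) h12
    (kLevelEvenDiscr_of_heegnerNonTorsion_of_nonHeegnerHalf hnf hGZ hHP hNT hRest)

end Summit.BirchSwinnertonDyer.BirchSwinnertonDyer.Theorems.GoldfeldGoodTwists

end
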